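import Literature.Computability.AlgebraicComplexity.FSV18SparseHittingProofs
import HarnessLib

/-!
# Depth-`D` occur-`k` formulas: Cor. 49 from Thm. 48 (Forbes–Shpilka–Volk 2018, §5.4) —
# a reduction

Sibling proofs file of `FSV18SuccinctGenerators.lean` (§5.4). That file types FSV Thm. 48
(`FSV2018_thm48`, "(a variant of) a theorem proved by Agrawal et al." [ASSS16]), Cor. 49
(`FSV2018_cor49`, the hitting half; the succinctness half = Fact 47 is proved there as
`isSuccinctGenerator_asssGenCoeff`) and the occur bullet of the summary Thm. 9
(`FSV2018_thm9_occur`) as named facts. Here the printed one-line derivation of Cor. 49 is PROVED;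
with `FSV2018_thm9_occur_of_cor49` (`FSV18Thm9Assembly.lean`, val-lit p1) the occur conjunct of the
LOAD-BEARING `FSV2018_thm9` then hangs on `FSV2018_thm48` [ASSS16] alone:

* `FSV2018_cor49_of_thm48 : FSV2018_thm48 → FSV2018_cor49` — as printed: "Immediate from
  Theorem 48, Corollary 34 and Proposition 17, by possibly restricting excess `y_ℓ` variables to
  `0`." Thm. 48 is applied with `Φ :=` the shifted SV block `G^{SSSV}_{n, R⌈log s⌉ + R⌈log R⌉}` of
  Construction 46, a generator for the polynomials with at most `R!·s^R ≤ 2^{R⌈log s⌉ + R⌈log R⌉}`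
  monomials by Cor. 34 (DISCHARGED: `ForbesShpilkaVolk2018_svGeneratorHitsSparse_holds`,
  `FSV18SparseHittingProofs.lean`); the generator `Ψ_r` it returns is the image of `G^{ASSS}`
  (`asssGenCoeff`) under the substitution "`t_0 ↦ t`, `t_i ↦ t^{2^{i-1}}`" (Prop. 17,
  `bind₁_binaryPowersSubst_rcGenCoeff`) composed with "`y_{ℓ,j} ↦ 0` for `j ≥ r_ℓ`"
  (`bind₁_truncSubst_vdmGenCoeff`), hence `D ∘ G^{ASSS} ≢ 0` whenever `D ∘ Ψ_r ≢ 0`.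
No new statements; no named facts introduced; this file cannot live inside
`FSV18SuccinctGenerators.lean` (it needs `FSV18SparseHittingProofs.lean`, which imports that file).

## References
* [ForbesShpilkaVolk2018] M. Forbes, A. Shpilka, B. L. Volk, *Succinct hitting sets and barriers to
  proving lower bounds for algebraic circuits*, Theory Comput. 14 (2018), arXiv:1701.05328:
  Prop. 17, Cor. 34, Construction 46, Fact 47, Thm. 48, Cor. 49 (seq.; = ToC 4.2, 5.10,
  5.22–5.25), Thm. 9 (= ToC Thm. 1.10), Lemma 14 (= ToC 3.3).
  locator: paper:arxiv-1701.05328 p0021.txt:L11–L45; paper:doi-10-4086-toc-2018-v014a018 pp. 29–30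
* [ASSS16] M. Agrawal, C. Saha, R. Saptharishi, N. Saxena, *Jacobian hits circuits: hitting sets,
  lower bounds for depth-D occur-k formulas and depth-3 transcendence degree-k circuits*, SIAM J.
  Comput. 45 (2016) (arXiv:1111.0582), Thm. 1.2 — the source of Thm. 48 (not proved here).
-/

noncomputable section

namespace Literature.Computability.AlgebraicComplexity

open MvPolynomial
open Literature.Barriers.ValiantsHypothesis

variable {F : Type*} [Field F] {n : ℕ}

/-- `rename` as a `bind₁` (plumbing). [folklore] -/
private theorem rename_eq_bind₁_X {σ τ R : Type*} [CommSemiring R] (g : σ → τ)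
    (p : MvPolynomial σ R) : rename g p = bind₁ (fun i => (X (g i) : MvPolynomial τ R)) p := by
  induction p using MvPolynomial.induction_on with
  | C a => simp
  | add p q hp hq => simp [hp, hq]
  | mul_X p i hp => simp [hp]

/-- Truncating a Vandermonde block: zeroing the `y_j` with `j ≥ r'` in `∑_{j<r} y_j t^{ij}` leaves
`∑_{j<r'} y_j t^{ij}` ("by possibly restricting excess `y_ℓ` variables to `0`", proof of Cor. 49).
[cite: ForbesShpilkaVolk2018, Cor. 49 (seq.) = ToC Cor. 5.25, p. 30 (proof)] -/
private theorem bind₁_truncSubst_vdmGenCoeff {r' r : ℕ} (h : r' ≤ r) (m : Fin n →₀ ℕ) :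
    bind₁ (Sum.elim (fun j : Fin r => if h : (j : ℕ) < r' then
          (X (Sum.inl ⟨j, h⟩) : MvPolynomial (Fin (r') ⊕ Unit) F) else 0)
        fun u => X (Sum.inr u))
      (vdmGenCoeff F n r m) = vdmGenCoeff F n r' m := by
  let f : ℕ → MvPolynomial (Fin r' ⊕ Unit) F := fun j =>
    (if h : j < r' then (X (Sum.inl ⟨j, h⟩) : MvPolynomial (Fin r' ⊕ Unit) F) else 0) *
      X (Sum.inr ()) ^ ((j + 1) * binIndex m)
  have hl : bind₁ (Sum.elim (fun j : Fin r => if h : (j : ℕ) < r' then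
          (X (Sum.inl ⟨j, h⟩) : MvPolynomial (Fin (r') ⊕ Unit) F) else 0)
        fun u => X (Sum.inr u))
      (vdmGenCoeff F n r m) = ∑ j : Fin r, f j := by
    rw [vdmGenCoeff, map_sum]
    refine Finset.sum_congr rfl fun j _ => ?_
    rw [map_mul, map_pow, bind₁_X_right, bind₁_X_right]
    rfl
  have hr : vdmGenCoeff F n r' m = ∑ j : Fin r', f j := by
    rw [vdmGenCoeff]
    refine Finset.sum_congr rfl fun j _ => ?_
    simp only [f, dif_pos j.2, Fin.eta]
  rw [hl, hr, Fin.sum_univ_eq_sum_range f r, Fin.sum_univ_eq_sum_range f r']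
  symm
  refine Finset.sum_subset (Finset.range_subset_range.2 h) fun j _ hj' => ?_
  have hjr' : ¬ j < r' := fun h' => hj' (Finset.mem_range.2 h')
  simp only [f, dif_neg hjr', zero_mul]


/-- The seed count of the shifted SV block of Construction 46 suffices for Thm. 48's sparsity
`R!·s^R`: `2^{R⌈log s⌉ + R⌈log R⌉} ≥ s^R · R^R ≥ s^R · R!`.
[cite: ForbesShpilkaVolk2018, Construction 46 and Cor. 49 (seq.) = ToC 5.22 / 5.25, pp. 29–30] -/
private theorem factorial_mul_pow_le_two_pow_asssK (k D s : ℕ) :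
    (asssR k D).factorial * s ^ asssR k D ≤ 2 ^ asssK k D s :=
  calc (asssR k D).factorial * s ^ asssR k D
      ≤ (2 ^ Nat.clog 2 (asssR k D)) ^ asssR k D * (2 ^ Nat.clog 2 s) ^ asssR k D :=
        Nat.mul_le_mul
          ((Nat.factorial_le_pow _).trans (Nat.pow_le_pow_left (Nat.le_pow_clog one_lt_two _) _))
          (Nat.pow_le_pow_left (Nat.le_pow_clog one_lt_two s) _)
    _ = 2 ^ asssK k D s := by rw [asssK, pow_add, pow_mul', pow_mul', mul_comm]

/-- **FSV Cor. 49 (ToC Cor. 5.25) PROVED modulo Thm. 48** — as in print: "Immediate from Theorem 48,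
Corollary 34 and Proposition 17, by possibly restricting excess `y_ℓ` variables to `0`": Thm. 48
is applied with `Φ :=` the shifted SV block `G^{SSSV}_{n, R log s + R log R}` of Construction 46,
which hits every polynomial with at most `R!·s^R ≤ 2^{R log s + R log R}` monomials (Cor. 34,
discharged in `FSV18SparseHittingProofs.lean`); the resulting generator `Ψ_r` is the image of
`G^{ASSS}` under the substitution `t_0 ↦ t`, `t_k ↦ t^{2^{k-1}}` (Prop. 17), `y_{ℓ,j} ↦ 0` for
`j ≥ r_ℓ`, so `D ∘ G^{ASSS} = 0` would force `D ∘ Ψ_r = 0`.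
[cite: ForbesShpilkaVolk2018, Cor. 49 (seq.) = ToC Cor. 5.25, p. 30] -/
theorem FSV2018_cor49_of_thm48 (h48 : FSV2018_thm48) : FSV2018_cor49 := by
  intro F _ n D k s hchar
  have hΦ : IsHittingSetGenerator
      {P : MvPolynomial (multilinearMonomials n) F |
        P.support.card ≤ (asssR k D).factorial * s ^ asssR k D}
      (fun m : multilinearMonomials n => svGenCoeff F n (asssK k D s) (m : Fin n →₀ ℕ)) := by
    intro P hP hP0
    exact ForbesShpilkaVolk2018_svGeneratorHitsSparse_holds F n (asssK k D s) P hP0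
      (hP.trans (factorial_mul_pow_le_two_pow_asssK k D s))
  obtain ⟨r, hr⟩ := h48 F n D k s _ _ hchar hΦ
  intro P hP hP0 hzero
  refine hr P hP hP0 ?_
  -- the seed slots of block `ℓ`'s truncated Vandermonde map inside `Ψ_r`'s seed type
  let ιℓ : (ℓ : Fin (D - 2)) → Fin (r ℓ) ⊕ Unit →
      (Fin (D - 2) × (Fin (asssR k D) ⊕ Unit)) ⊕
        (Fin (asssK k D s) ⊕ (Fin (asssK k D s) × Fin n)) :=
    fun ℓ v => Sum.inl (ℓ, Sum.map (Fin.castLE (Nat.lt_succ_iff.mp (r ℓ).isLt)) id v)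
  -- the substitution: binary powers of `t_ℓ` for the `t`-seeds (Prop. 17), excess `y`'s to `0`,
  -- SV seeds kept
  let θ : (Fin (D - 2) × (Fin (asssR k D) ⊕ Fin (n + 1))) ⊕
      (Fin (asssK k D s) ⊕ (Fin (asssK k D s) × Fin n)) →
      MvPolynomial ((Fin (D - 2) × (Fin (asssR k D) ⊕ Unit)) ⊕
        (Fin (asssK k D s) ⊕ (Fin (asssK k D s) × Fin n))) F :=
    Sum.elim
      (fun p => rename (ιℓ p.1)
        (bind₁ (Sum.elim (fun j : Fin (asssR k D) => if h : (j : ℕ) < r p.1 then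
              (X (Sum.inl ⟨j, h⟩) : MvPolynomial (Fin (r p.1) ⊕ Unit) F) else 0)
            fun u => X (Sum.inr u))
          (binaryPowersSubst F n (asssR k D) p.2)))
      fun v => X (Sum.inr v)
  have hθ : ∀ m : multilinearMonomials n,
      (∑ ℓ : Fin (D - 2), rename (ιℓ ℓ) (vdmGenCoeff F n (r ℓ) (m : Fin n →₀ ℕ))) +
        rename Sum.inr (svGenCoeff F n (asssK k D s) (m : Fin n →₀ ℕ)) =
      bind₁ θ (asssGenCoeff F D k n s (m : Fin n →₀ ℕ)) := by
    intro m
    rw [asssGenCoeff, map_add, map_sum]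
    congr 1
    · refine Finset.sum_congr rfl fun ℓ _ => ?_
      rw [bind₁_rename]
      show _ = bind₁ (fun v => rename (ιℓ ℓ) (bind₁
        (Sum.elim (fun j : Fin (asssR k D) => if h : (j : ℕ) < r ℓ then
              (X (Sum.inl ⟨j, h⟩) : MvPolynomial (Fin (r ℓ) ⊕ Unit) F) else 0)
            fun u => X (Sum.inr u))
        (binaryPowersSubst F n (asssR k D) v))) _
      rw [← rename_bind₁, ← bind₁_bind₁, bind₁_binaryPowersSubst_rcGenCoeff,
        bind₁_truncSubst_vdmGenCoeff (Nat.lt_succ_iff.mp (r ℓ).isLt)]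
    · rw [bind₁_rename]
      show _ = bind₁ (fun v => X (Sum.inr v)) _
      rw [← rename_eq_bind₁_X]
  show bind₁ (fun m : multilinearMonomials n =>
      (∑ ℓ : Fin (D - 2), rename (ιℓ ℓ) (vdmGenCoeff F n (r ℓ) (m : Fin n →₀ ℕ))) +
        rename Sum.inr (svGenCoeff F n (asssK k D s) (m : Fin n →₀ ℕ))) P = 0
  rw [funext hθ, ← bind₁_bind₁, hzero, map_zero]

end Literature.Computability.AlgebraicComplexity
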